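import Summits.ABC.IUTFork.Thm311RealDH
import Summits.ABC.IUTFork.Thm311RealM
import Summits.ABC.IUTFork.Thm311RealLattice
import HarnessLib

/-!
# [IUTchIII] Theorem 3.11 over real definitions, F: the Dupuy–Hilado indeterminacies for ANY log-shell signature (M level included)

Record-only file (D-0012) of the abc-iut cell (Cor. 3.12 sub-crew, wave-2 seat abc-iut-c312-5, board row
W2-A); TAKES NO SIDE on [IUTchIII] Cor. 3.12. `Thm311RealDH` (p406504) instantiated the automorphism slots
`stripAut`/`Ism` of abc-iut-c312-1's `Thm311.LogShells` at the DUPUY–HILADO level for the pilot-data carriers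
of `Thm311Real` (strip part `{1}`, DH §4.7; at a finite place the bicontinuous `ℚ`-linear automorphisms with
`φ(I_v) = I_v`, DH §4.9; `{±1}` at an infinite place, [IUTchIII] Thm. 3.11 (i) (Ind2) p. 154 l. 59–60). This
file performs the SAME replacement for ANY log-shell signature `L : Thm311.LogShells T` whose carriers carry
topologies — `LogShells.toDH L` keeps the carriers and shells of `L` and overwrites the two automorphism slots by
the DH sets — and applies it to the M-LEVEL signature `Real.logShellsOfInitial D …` of `Thm311RealM` (p405784;
index sets and carriers from [IUTchI] Def. 3.1 via abc-iut-L5-t2's `InitialThetaData`): `Real.logShellsOfInitialDH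
D logvK`, with NO automorphism binder left at the M level either (the `p`-adic-log binder `logvK` subject to the
same caveat as in `Thm311RealDH`: the DH reading is the printed one under the law `O_v ⊆ I_v`, abc-iut-L6-t3's
`IntegersSubsetLogShell`; stated here as `Real.LogvLawVal`).

PROVED (bookkeeping): `toDH_stripAut`, `toDH_ism_of_isNon`, `toDH_ism_of_not_isNon`,
`image_shell_of_mem_toDH_ism`, and (appended) `toDH_ind1_image_shellPk` / `toDH_ind2_image_shellPk`:
(Ind1)/(Ind2) of `toDH` preserve the defined integral structures `shellPk` (via `Thm311RealLattice`), `neg_mem_toDH_ism` (a symmetric shell with continuous negation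
admits `−1`: (Ind2) non-vacuous).
[cite: DupuyHilado2025, §4.7, §4.9] [claim: Mochizuki2012, status: disputed]
RESIDUAL → owner: `logvK` → abc-iut-S1/abc-iut-L6-t3 (analytic log on `K_v`; see `Thm311RealDH` caveat and the
c312-5 normalisation note of 2026-08-25 on `NormedAlgebra ℚ_[p] K_v`). typed ≠ discharged; instantiated ≠ endorsed.
-/

noncomputable section

open scoped Classical

namespace Summit.ABC.IUTFork.Thm311

open NumberField IsDedekindDomain Literature.IUT.LogVolume Literature.IUT.LogThetaLattice

variable {T : ThetaIndex}

namespace LogShells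

variable (L : LogShells T) (τ : ∀ v : T.V, TopologicalSpace (L.carrier v))

/-- The DUPUY–HILADO "Ism" set on the carrier at `v`, for a signature with topologised carriers: at a `v` over a
NONARCHIMEDEAN `v_ℚ`, the bicontinuous `ℚ`-linear automorphisms `φ` with `φ(I_v) = I_v` (DH §4.9 "lattice
isomorphisms of `I_v`" — DH's group when `I_v` is a full lattice); over an ARCHIMEDEAN `v_ℚ`, `{1, −1}` ([IUTchIII]
Thm. 3.11 (i) (Ind2), p. 154 l. 59–60: "automorphisms of order 2") — with the SAME residual as `Thm311RealDH`: the
printed order-2 automorphisms act factor-wise on `k~ = C~ × C~` ([AbsTopIII] Prop. 5.8 (v); abc-iut-L4-t3), which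
`{±1}` on the single carrier does NOT model (ref-b PASS-B6 B6-6). [cite: DupuyHilado2025, §4.9] -/
def dhIsm (v : T.V) : Set (L.carrier v ≃ₗ[ℚ] L.carrier v) :=
  if T.IsNon (T.over v) then
    {φ : L.carrier v ≃ₗ[ℚ] L.carrier v |
      @Continuous _ _ (τ v) (τ v) φ ∧ @Continuous _ _ (τ v) (τ v) φ.symm ∧ φ '' L.shell v = L.shell v}
  else {LinearEquiv.refl ℚ (L.carrier v), LinearEquiv.neg ℚ}

/-- The identity lies in the DH Ism set. [folklore] -/
theorem refl_mem_dhIsm (v : T.V) : LinearEquiv.refl ℚ (L.carrier v) ∈ L.dhIsm τ v := by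
  unfold dhIsm
  split_ifs with h
  · exact ⟨@continuous_id _ (τ v), @continuous_id _ (τ v), Set.image_id _⟩
  · exact Set.mem_insert _ _

/-- **`LogShells.toDH`**: the SAME carriers and log-shells as `L`, with the automorphism slots replaced by the
Dupuy–Hilado ones — strip part `{1}` (DH §4.7: the full-poly-isomorphism indeterminacy is realised on the
packets by the capsule permutations, which abc-iut-c312-1's `Ind1` adds by itself), `Ism := dhIsm` (archimedean
residual: factor-wise signs on `C~ × C~` not modelled, as in `Thm311RealDH`). [cite: DupuyHilado2025, §4.7, §4.9] -/
def toDH : LogShells T where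
  carrier := L.carrier
  shell := L.shell
  stripAut v := {LinearEquiv.refl ℚ (L.carrier v)}
  ism := L.dhIsm τ
  one_mem_stripAut _ := Set.mem_singleton _
  one_mem_ism := L.refl_mem_dhIsm τ

/-- `toDH` keeps the carriers. [folklore] -/
theorem toDH_carrier : (L.toDH τ).carrier = L.carrier := rfl

/-- `toDH` keeps the shells. [folklore] -/
theorem toDH_shell : (L.toDH τ).shell = L.shell := rfl

/-- The strip-automorphism slot of `toDH` is trivial. [cite: DupuyHilado2025, §4.7] -/
theorem toDH_stripAut (v : T.V) : (L.toDH τ).stripAut v = {LinearEquiv.refl ℚ (L.carrier v)} := rfl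

/-- Over a nonarchimedean `v_ℚ` the Ism slot of `toDH` is the set of bicontinuous shell-preserving automorphisms.
[cite: DupuyHilado2025, §4.9] -/
theorem toDH_ism_of_isNon {v : T.V} (h : T.IsNon (T.over v)) :
    (L.toDH τ).ism v =
      {φ : L.carrier v ≃ₗ[ℚ] L.carrier v |
        @Continuous _ _ (τ v) (τ v) φ ∧ @Continuous _ _ (τ v) (τ v) φ.symm ∧ φ '' L.shell v = L.shell v} :=
  if_pos h

/-- Over an archimedean `v_ℚ` the Ism slot of `toDH` is `{1, −1}`. [claim: Mochizuki2012, status: disputed] -/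
theorem toDH_ism_of_not_isNon {v : T.V} (h : ¬ T.IsNon (T.over v)) :
    (L.toDH τ).ism v = {LinearEquiv.refl ℚ (L.carrier v), LinearEquiv.neg ℚ} :=
  if_neg h

/-- Every element of the Ism slot of `toDH` over a nonarchimedean `v_ℚ` maps the shell onto itself — the
hypothesis of `LogShells.image_shellPk_of_mem_Ind2` (`Thm311RealLattice`): so (Ind2) of `toDH` preserves the
defined integral structures there. [cite: DupuyHilado2025, §4.9] -/
theorem image_shell_of_mem_toDH_ism {v : T.V} (h : T.IsNon (T.over v)) {g : L.carrier v ≃ₗ[ℚ] L.carrier v}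
    (hg : g ∈ (L.toDH τ).ism v) : g '' L.shell v = L.shell v := by
  rw [toDH_ism_of_isNon L τ h] at hg
  exact hg.2.2

/-- NON-VACUITY of (Ind2) for `toDH`: over a nonarchimedean `v_ℚ`, if the shell is symmetric and negation is
continuous, `−1 ∈ Ism`. [folklore] -/
theorem neg_mem_toDH_ism {v : T.V} (h : T.IsNon (T.over v)) (hneg : @Continuous _ _ (τ v) (τ v) fun x : L.carrier v => -x)
    (hsymm : ∀ x ∈ L.shell v, -x ∈ L.shell v) : LinearEquiv.neg ℚ ∈ (L.toDH τ).ism v := by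
  rw [toDH_ism_of_isNon L τ h]
  refine ⟨hneg, hneg, ?_⟩
  ext y
  constructor
  · rintro ⟨x, hx, rfl⟩; exact hsymm x hx
  · intro hy; exact ⟨-y, hsymm y hy, neg_neg y⟩

end LogShells

/-! ## The M level: DH indeterminacies on the carriers of `Thm311RealM` -/

namespace Real

open Literature.IUT.HodgeTheaters

section Law

variable {K : Type} [Field K] [NumberField K]

/-- The LAW on the M-level `p`-adic-log binder under which the DH reading is the printed one: `O_v ⊆ I_v` at every
finite `v ∈ V̲` (abc-iut-L6-t3's `IntegersSubsetLogShell`; cf. `Real.LogvLaw`). [claim: Mochizuki2012, status: disputed] -/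
def LogvLawVal (logv : PadicLogsVal K) : Prop :=
  ∀ w : FinitePlace K, IntegersSubsetLogShell (integersVal w) (logv w) (residueChar K (FinitePlace.maximalIdeal w))

end Law

variable {F : Type} [Field F] [NumberField F]
  {K Fbar : Type} [Field K] [NumberField K] [Algebra F K] [Field Fbar] [Algebra F Fbar] [Algebra K Fbar]
  {E : WeierstrassCurve F} [E.IsElliptic] {l : ℕ} {Pb : BadPlacePredicates K}
  (D : InitialThetaData F K Fbar E l Pb) (logvK : PadicLogsVal K)

/-- The M-level log-shell signature with TRIVIAL automorphism binders (to be overwritten by `toDH`).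
[claim: Mochizuki2012, status: disputed] -/
abbrev logShellsOfInitial₁ : LogShells (thetaIndexOfInitial D) :=
  logShellsOfInitial D logvK (fun _ => {LinearEquiv.refl ℚ _}) (fun _ => {LinearEquiv.refl ℚ _})
    (fun _ => Set.mem_singleton _) (fun _ => Set.mem_singleton _)

/-- The topologies of the M-level carriers `K_v` (`Real.CarrierVal`: `w.Completion` / `adicCompletion`), handed to
`toDH` explicitly (instance search does not see through the signature's `carrier` projection). [folklore] -/
abbrev topologyOfInitial (v : (thetaIndexOfInitial D).V) : TopologicalSpace ((logShellsOfInitial₁ D logvK).carrier v) :=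
  inferInstanceAs (TopologicalSpace (CarrierVal v.1))

/-- **The M-LEVEL log-shell signature with the Dupuy–Hilado indeterminacies**: carriers `K_v` and shells
`(p_v^*)⁻¹·log_v(O_v^×)` / `π`-balls of `Real.logShellsOfInitial` (index sets from [IUTchI] Def. 3.1 via
`InitialThetaData`), strip slot `{1}`, Ism = lattice isomorphisms of `I_v` (finite `v`) / `{±1}` (infinite `v`).
The only binder left is the family of `p_v`-adic logarithms `logvK` (subject to `LogvLawVal`).
[cite: DupuyHilado2025, §4.7, §4.9] -/
def logShellsOfInitialDH : LogShells (thetaIndexOfInitial D) :=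
  (logShellsOfInitial₁ D logvK).toDH (topologyOfInitial D logvK)

/-- Its carriers are the `K_v`. [folklore] -/
theorem logShellsOfInitialDH_carrier (v : (thetaIndexOfInitial D).V) :
    (logShellsOfInitialDH D logvK).carrier v = CarrierVal v.1 := rfl

end Real

/-! ## (Ind1)/(Ind2) of `toDH` preserve the integral structures (appended; via `Thm311RealLattice`) -/

namespace LogShells

variable (L : LogShells T) (τ : ∀ v : T.V, TopologicalSpace (L.carrier v))

/-- **(Ind1) of `toDH` fixes the integral structures** `I(^{S^±_{j+1}};D⊢_{v_ℚ})` at every `v_ℚ` (strip slot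
trivial; `Thm311RealLattice`'s `image_shellPk_of_mem_Ind1`; Dupuy–Hilado §4.7 p. 14) — for every `L`.
[cite: DupuyHilado2025, §4.7] -/
theorem toDH_ind1_image_shellPk {j : T.Label}
    {Φ : ∀ vQ : T.VQ, (L.toDH τ).Packet j vQ ≃ₗ[ℚ] (L.toDH τ).Packet j vQ} (hΦ : Φ ∈ (L.toDH τ).Ind1 j)
    (vQ : T.VQ) :
    Φ vQ '' ((L.toDH τ).shellPk j vQ : Set ((L.toDH τ).Packet j vQ)) = (L.toDH τ).shellPk j vQ :=
  (L.toDH τ).image_shellPk_of_mem_Ind1 (fun v h hh => by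
    have : h = LinearEquiv.refl ℚ _ := hh
    subst this
    exact Set.image_id' _) hΦ vQ

/-- **(Ind2) of `toDH` preserves the integral structures** `I(^{S^±_{j+1}};D⊢_{v_ℚ})` over every NONARCHIMEDEAN
`v_ℚ` (`Thm311RealLattice`'s `image_shellPk_of_mem_Ind2`; Dupuy–Hilado §4 p. 13) — for every `L`; set
preservation, no law on the shells needed. [cite: DupuyHilado2025, §4.9] -/
theorem toDH_ind2_image_shellPk {j : T.Label} {vQ : T.VQ} (hvQ : T.IsNon vQ)
    {φ : (L.toDH τ).Packet j vQ ≃ₗ[ℚ] (L.toDH τ).Packet j vQ} (hφ : φ ∈ (L.toDH τ).Ind2 j vQ) :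
    φ '' ((L.toDH τ).shellPk j vQ : Set ((L.toDH τ).Packet j vQ)) = (L.toDH τ).shellPk j vQ :=
  (L.toDH τ).image_shellPk_of_mem_Ind2
    (fun v _ hg => L.image_shell_of_mem_toDH_ism τ (v.2.symm ▸ hvQ) hg) hφ

end LogShells

/-! ## Non-vacuity of (Ind2) at the M level (appended; theorems only) -/

namespace Real

open Literature.IUT.HodgeTheaters

variable {F : Type} [Field F] [NumberField F]
  {K Fbar : Type} [Field K] [NumberField K] [Algebra F K] [Field Fbar] [Algebra F Fbar] [Algebra K Fbar]
  {E : WeierstrassCurve F} [E.IsElliptic] {l : ℕ} {Pb : BadPlacePredicates K}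
  (D : InitialThetaData F K Fbar E l Pb) (logvK : PadicLogsVal K)

omit [NumberField F] [Algebra F K] [Algebra F Fbar] [Algebra K Fbar] [E.IsElliptic] in
/-- The M-level log-shell `(p_v^*)⁻¹·log_v(O_v^×)` at a finite place is symmetric: `−log_v(u) = log_v(u⁻¹)`.
[folklore] -/
theorem neg_mem_shellVal_non (logv : PadicLogsVal K) (w : FinitePlace K) {a : CarrierVal (Val.non w)}
    (ha : a ∈ shellVal logv (Val.non w)) : -a ∈ shellVal logv (Val.non w) := by
  change a ∈ nonarchLogShell (integersVal w) (logv w) (residueChar K (FinitePlace.maximalIdeal w)) at ha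
  change -a ∈ nonarchLogShell (integersVal w) (logv w) (residueChar K (FinitePlace.maximalIdeal w))
  obtain ⟨x, rfl⟩ := ha
  exact ⟨x⁻¹, by rw [ofMul_inv, map_neg, mul_neg]⟩

/-- A member of `V̲` at a finite place of `K` lies over a nonarchimedean `v_ℚ` (restriction of valuations
preserves `V^non`). [folklore] -/
theorem isNon_over_non (w : FinitePlace K) (hw : Val.non w ∈ D.V) :
    (thetaIndexOfInitial D).IsNon ((thetaIndexOfInitial D).over ⟨Val.non w, hw⟩) := rfl

/-- **NON-VACUITY of (Ind2) at the M level**: at every finite `v ∈ V̲`, `−1 ∈ Ism_v` for the Dupuy–Hilado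
indeterminacies `Real.logShellsOfInitialDH` (negation is bicontinuous, `ℚ`-linear and maps `I_v` onto itself) —
so (Ind2) of the M-level DH instance moves packet elements; cf. `Real.neg_mem_ismDH_inr` at the DH level.
[cite: DupuyHilado2025, §4.9] -/
theorem neg_mem_ism_logShellsOfInitialDH (w : FinitePlace K) (hw : Val.non w ∈ D.V) :
    LinearEquiv.neg ℚ ∈ (logShellsOfInitialDH D logvK).ism ⟨Val.non w, hw⟩ :=
  LogShells.neg_mem_toDH_ism _ _ (isNon_over_non D w hw)
    (continuous_neg : Continuous fun x : CarrierVal (Val.non w) => -x)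
    (fun _ ha => neg_mem_shellVal_non logvK w ha)

/-- Hence (Ind2) of the M-level DH instance preserves the integral structures over every prime AND is
non-trivial there: the packet automorphism acting by `−1` on one summand of one factor lies in `Ind2 j v_ℚ`
(any family drawn from `Ism`): the all-`(−1)` family is in `Ind2 j v_ℚ` for the `v_ℚ` below any finite
`w₀ ∈ V̲` (archimedean members of `V̲` do not lie over it). [cite: DupuyHilado2025, §4.9] -/
theorem negFamily_mem_Ind2_logShellsOfInitialDH (j : (thetaIndexOfInitial D).Label) (w₀ : FinitePlace K)
    (hw₀ : Val.non w₀ ∈ D.V) :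
    ((logShellsOfInitialDH D logvK).factorwise j _ fun _ : (thetaIndexOfInitial D).Caps j =>
        (logShellsOfInitialDH D logvK).summandwise _ fun _ => LinearEquiv.neg ℚ) ∈
      (logShellsOfInitialDH D logvK).Ind2 j ((thetaIndexOfInitial D).over ⟨Val.non w₀, hw₀⟩) := by
  refine ⟨fun _ _ => LinearEquiv.neg ℚ, fun _ v => ?_, rfl⟩
  obtain ⟨⟨x, hxV⟩, hx⟩ := v
  rcases x with u | w
  · -- an archimedean member of `V̲` cannot lie over the nonarchimedean `v_ℚ` below `w₀`
    exact absurd hx Sum.inl_ne_inr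
  · exact neg_mem_ism_logShellsOfInitialDH D logvK w hxV

end Real

end Summit.ABC.IUTFork.Thm311

end
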